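import Summits.Ventures.CertifiedArithmetic.LowPrec.GemmFirstRegimeLaw
import HarnessLib

/-!
# GEMM worst case LXIV-a — THE SPINE INVARIANT, part 1: one binade of integer RNE, and the
# base/propagation arithmetic of the signed error bookkeeping

HONEST FRAMING: certified error envelopes and provably optimal rounding/accumulation schemes for
low-precision formats under stated cost models; every table by two implementations; no hardware or
vendor claims.

Files LXIV-a/b/c close the TOP SLIVER of the first regime left open by file LXIII-b
(`relErr_le_firstRegimeLaw`, hypothesis (H1), `k ≲ T/2 - 1.5M`): the exact law
`R(x, n₀ + k) ≤ max(k/(B+k), (k-1)/(T+k-1))` holds for EVERY `k ≤ T/2 = 2^(p-1)`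
(`relErr_le_firstRegimeLaw_all`, file LXIV-c).  The restart-plus-Lange–Rump argument of LXIII-b
loses the letter bound `M` at the `2T` crossing; the new argument is an INTEGER bookkeeping of the
SIGNED error `E_j = ŝ_j - s_j` against the signed slack `X⁻_j = L_j - E_j` along the word
(the "spine"), in grid units, with `T = 2^(m+1)`, `m = manBits`:

* This file.  (i) ONE BINADE OF INTEGER RNE (`rneZ_level`; below `T` RNE is the identity,
  `ThetaLawE2M1.rneZ_of_natAbs_lt` of file GemmThetaLawE2M1Law): for `2^(m+e+1) ≤ |K| < 2^(m+e+2)`,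
  `rneZ m K` keeps the sign, stays `≥ 2^(m+e+1)` in modulus, is a multiple of `2^(e+1)`, errs by
  `≤ 2^e`, and AT A TIE is a multiple of `2^(e+2)` (ties-to-even — load-bearing below);
  `rneZ_err_le`: `|rneZ m K - K| ≤ 2^e` whenever `|K| < 2^(m+e+2)`.  (ii) The four BASE
  inequalities `T·E_b + (d-1-a)·U ≤ d·X⁻_b` right after the first step at level `U = 2T·h`
  (`spine_base_neg/pos0/pos1/pos2`: pure polynomial arithmetic in `T, h, a, d`), and the
  PROPAGATION `spine_propagate` (each later step costs `≤ 2h = U/T` of error and never decreases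
  `X⁻`).  (iii) The integer objects `sZ, LZ, accZ`, cast helpers, and the a-priori growth
  `|ŝ_{j₀+t}| ≤ (M(j₀+1) + 2Mt)/2^G` of a recursive sum after an exact prefix.
* File LXIV-b (`spineZ`, `spineZ_abs`): the spine theorem `(T + d)·|ŝ_n - s_n| ≤ d·L_n` for high
  words.  File LXIV-c: the bridge `seqSum = accZ/2^G` and the law rows on the whole first regime.

References: [Higham2002, §4.2], [IEEE7542019, §4.3.1] (ties-to-even), [LangeRump2019],
[BoldoEtAl2023, Thm 4.5] (the bound `d/(T+d)` this generalises to a prefix-exact start).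
-/

namespace Summit.Ventures.CertifiedArithmetic.LowPrec.Gemm

open Literature.ComputerArithmetic.FloatingPoint
open Literature.ComputerArithmetic.FloatingPoint.MiniFloat
open Literature.ComputerArithmetic.JeannerodRump2018
open Finset

variable {φ : Format}

/-! ### Integer round-to-nearest-even (`rneZ`): exactness below `T`, and one binade -/

/-- THE BINADE FACTS of integer RNE (magnitudes `n` with `2^(m+e+1) ≤ n < 2^(m+e+2)`, spacing
`2^(e+1)`, half-spacing `2^e`): the result is at least the binade's lower end, is a multiple of the
spacing, errs by at most half a spacing, and after a TIE it is a multiple of twice the spacing (even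
significand). [cite: IEEE7542019, §4.3.1] -/
theorem rneSigMag_level {m e n : ℕ} (hlo : 2 ^ (m + e + 1) ≤ n) (hhi : n < 2 ^ (m + e + 2)) :
    2 ^ (m + e + 1) ≤ rneSigMag m n ∧ 2 ^ (e + 1) ∣ rneSigMag m n ∧
    n ≤ rneSigMag m n + 2 ^ e ∧ rneSigMag m n ≤ n + 2 ^ e ∧
    ((rneSigMag m n = n + 2 ^ e ∨ n = rneSigMag m n + 2 ^ e) → 2 ^ (e + 2) ∣ rneSigMag m n) := by
  rw [rneSigMag_of_binade (e := e + 1) hlo hhi]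
  have hP0 : 0 < 2 ^ (e + 1) := by positivity
  set q := n / 2 ^ (e + 1) with hq
  set r := n % 2 ^ (e + 1) with hr
  have hrP : r < 2 ^ (e + 1) := Nat.mod_lt _ hP0
  have hn : n = q * 2 ^ (e + 1) + r := (Nat.div_add_mod' n (2 ^ (e + 1))).symm
  have hPe : 2 ^ (e + 1) = 2 * 2 ^ e := by ring
  have hP2 : 2 ^ (e + 2) = 2 * 2 ^ (e + 1) := by ring
  have hU : 2 ^ (m + e + 1) = 2 ^ m * 2 ^ (e + 1) := by ring
  have hqm : 2 ^ m ≤ q := by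
    by_contra h
    have h1 : (q + 1) * 2 ^ (e + 1) ≤ 2 ^ m * 2 ^ (e + 1) := Nat.mul_le_mul_right _ (by omega)
    have h2 : (q + 1) * 2 ^ (e + 1) = q * 2 ^ (e + 1) + 2 ^ (e + 1) := by ring
    omega
  have hqP : 2 ^ (m + e + 1) ≤ q * 2 ^ (e + 1) := by rw [hU]; exact Nat.mul_le_mul_right _ hqm
  rw [hn, rneShiftNat_of_decomp q hrP]
  have e1 : (q + 1) * 2 ^ (e + 1) = q * 2 ^ (e + 1) + 2 ^ (e + 1) := by ring
  split_ifs with h1 h2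
  · -- round down
    rw [add_zero]
    exact ⟨by omega, Dvd.intro_left q rfl, by omega, by omega, fun h => by omega⟩
  · -- round up
    rw [e1]
    refine ⟨by omega, ?_, by omega, by omega, fun h => by omega⟩
    rw [← e1]; exact Dvd.intro_left (q + 1) rfl
  · -- tie: to even
    have hr2 : 2 * r = 2 ^ (e + 1) := by omega
    rcases Nat.mod_two_eq_zero_or_one q with hq2 | hq2
    · rw [hq2, add_zero]
      refine ⟨by omega, Dvd.intro_left q rfl, by omega, by omega, fun _ => ?_⟩
      rw [hP2]
      exact mul_dvd_mul (Nat.dvd_of_mod_eq_zero hq2) (dvd_refl _)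
    · rw [hq2, e1]
      refine ⟨by omega, ?_, by omega, by omega, fun _ => ?_⟩
      · rw [← e1]; exact Dvd.intro_left (q + 1) rfl
      · rw [← e1, hP2]
        exact mul_dvd_mul (by omega) (dvd_refl _)

/-- The binade facts for the signed rounding `rneZ`. [cite: IEEE7542019, §4.3.1] -/
theorem rneZ_level {m e : ℕ} {K : ℤ} (hlo : 2 ^ (m + e + 1) ≤ K.natAbs)
    (hhi : K.natAbs < 2 ^ (m + e + 2)) :
    2 ^ (m + e + 1) ≤ (rneZ m K).natAbs ∧ (2 : ℤ) ^ (e + 1) ∣ rneZ m K ∧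
    (rneZ m K - K).natAbs ≤ 2 ^ e ∧
    ((rneZ m K - K).natAbs = 2 ^ e → (2 : ℤ) ^ (e + 2) ∣ rneZ m K) ∧
    (0 < K → 0 < rneZ m K) ∧ (K < 0 → rneZ m K < 0) := by
  obtain ⟨h1, h2, h3, h4, h5⟩ := rneSigMag_level hlo hhi
  have hRpos : 0 < rneSigMag m K.natAbs := lt_of_lt_of_le (by positivity) h1
  have h2z : (2 : ℤ) ^ (e + 1) ∣ (rneSigMag m K.natAbs : ℤ) := by
    exact_mod_cast Int.natCast_dvd_natCast.mpr h2
  have h5z : (rneSigMag m K.natAbs = K.natAbs + 2 ^ e ∨ K.natAbs = rneSigMag m K.natAbs + 2 ^ e) →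
      (2 : ℤ) ^ (e + 2) ∣ (rneSigMag m K.natAbs : ℤ) := fun h => by
    exact_mod_cast Int.natCast_dvd_natCast.mpr (h5 h)
  unfold rneZ
  by_cases hK : K < 0
  · rw [if_pos hK]
    refine ⟨by rw [Int.natAbs_neg, Int.natAbs_natCast]; exact h1, h2z.neg_right, by omega,
      fun h => (h5z (by omega)).neg_right, fun h => absurd hK (by omega), fun _ => by omega⟩
  · rw [if_neg hK]
    refine ⟨by rw [Int.natAbs_natCast]; exact h1, h2z, by omega, fun h => h5z (by omega),
      fun _ => by omega, fun h => absurd h hK⟩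

/-- `|rneZ K - K| ≤ 2^e` whenever `|K| < 2^(m+e+2)` (half a spacing of the coarsest binade met).
[cite: IEEE7542019, §4.3.1] -/
theorem rneZ_err_le {m : ℕ} : ∀ (e : ℕ) {K : ℤ}, K.natAbs < 2 ^ (m + e + 2) →
    (rneZ m K - K).natAbs ≤ 2 ^ e
  | 0, K, h => by
      by_cases hlt : K.natAbs < 2 ^ (m + 1)
      · rw [ThetaLawE2M1.rneZ_of_natAbs_lt hlt, sub_self]; simp
      · exact (rneZ_level (not_lt.mp hlt) h).2.2.1
  | e + 1, K, h => by
      by_cases hlt : K.natAbs < 2 ^ (m + e + 2)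
      · exact le_trans (rneZ_err_le e hlt) (Nat.pow_le_pow_right (by norm_num) (by omega))
      · exact (rneZ_level (e := e + 1) (not_lt.mp hlt) h).2.2.1

/-- Between consecutive multiples of `P`: `P ∣ A`, `P ∣ B`, `B < A` give `B + P ≤ A`. [folklore] -/
theorem add_le_of_dvd_of_lt {P A B : ℤ} (hP : 0 < P) (hA : P ∣ A) (hB : P ∣ B) (h : B < A) :
    B + P ≤ A := by
  obtain ⟨a, rfl⟩ := hA
  obtain ⟨b, rfl⟩ := hB
  have hab : b < a := lt_of_mul_lt_mul_left h hP.le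
  nlinarith

/-- `|δ| ≤ B` in the two signed forms. [folklore] -/
theorem le_of_natAbs_le' {δ : ℤ} {B : ℕ} (h : δ.natAbs ≤ B) : δ ≤ (B : ℤ) ∧ -(B : ℤ) ≤ δ := by
  omega

/-! ### Partial sums and masses of an integer word -/

/-- `s_j = Σ_{i ≤ j} z_i`. [cell] -/
def sZ (z : ℕ → ℤ) (j : ℕ) : ℤ := ∑ i ∈ range (j + 1), z i

/-- `L_j = Σ_{i ≤ j} |z_i|`. [cell] -/
def LZ (z : ℕ → ℤ) (j : ℕ) : ℤ := ∑ i ∈ range (j + 1), ((z i).natAbs : ℤ)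

/-- `s_{j+1} = s_j + z_{j+1}`. [folklore] -/
theorem sZ_succ (z : ℕ → ℤ) (j : ℕ) : sZ z (j + 1) = sZ z j + z (j + 1) := sum_range_succ _ _

/-- `L_{j+1} = L_j + |z_{j+1}|`. [folklore] -/
theorem LZ_succ (z : ℕ → ℤ) (j : ℕ) : LZ z (j + 1) = LZ z j + ((z (j + 1)).natAbs : ℤ) :=
  sum_range_succ _ _

/-- `|s_j| ≤ L_j`. [folklore] -/
theorem abs_sZ_le_LZ (z : ℕ → ℤ) (j : ℕ) : |sZ z j| ≤ LZ z j := by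
  unfold sZ LZ
  refine le_trans (abs_sum_le_sum_abs _ _) (le_of_eq (sum_congr rfl fun i _ => ?_))
  exact (Int.natCast_natAbs (z i)).symm

/-- The mirror word has the opposite partial sums. [folklore] -/
theorem sZ_neg (z : ℕ → ℤ) (j : ℕ) : sZ (fun i => -z i) j = -sZ z j := by
  unfold sZ; rw [sum_neg_distrib]

/-- The mirror word has the same masses. [folklore] -/
theorem LZ_neg (z : ℕ → ℤ) (j : ℕ) : LZ (fun i => -z i) j = LZ z j := by
  unfold LZ; exact sum_congr rfl fun i _ => by rw [Int.natAbs_neg]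

/-! ### The spine bookkeeping: base cases (pure arithmetic) and propagation -/

/-- BASE on the negative side: `E_b ≤ 1 + a·h + 2h`, `X⁻_b ≥ U`. [cell] -/
theorem spine_base_neg {T Hh U a d Eb Xb : ℤ} (hU : U = 2 * T * Hh) (hT : 0 ≤ T) (hHh : 1 ≤ Hh)
    (ha : 1 ≤ a) (hd : 0 ≤ d) (hEb : Eb ≤ 1 + a * Hh + 2 * Hh) (hXb : U ≤ Xb) :
    T * Eb + (d - 1 - a) * U ≤ d * Xb := by
  subst hU
  have h1 : 1 ≤ a * Hh := by nlinarith
  have h2 : Eb ≤ 2 * a * Hh + 2 * Hh := by linarith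
  have h3 := mul_le_mul_of_nonneg_left h2 hT
  have h4 := mul_le_mul_of_nonneg_left hXb hd
  linarith

/-- BASE on the positive side, U-step not rounded up: `E_b ≤ 1 + a·h`, `ŝ_b ≥ U`. [cell] -/
theorem spine_base_pos0 {T Hh U a d Eb Ab Xb : ℤ} (hU : U = 2 * T * Hh) (hT2d : 2 * d + 2 ≤ T)
    (hHh : 1 ≤ Hh) (ha : 1 ≤ a) (hd : 0 ≤ d) (hEb : Eb ≤ 1 + a * Hh) (hAb : U ≤ Ab)
    (hXb : Ab - 2 * Eb ≤ Xb) : T * Eb + (d - 1 - a) * U ≤ d * Xb := by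
  subst hU
  have hT : 0 ≤ T := by linarith
  have h1 := mul_le_mul_of_nonneg_left hEb (by linarith : (0 : ℤ) ≤ T + 2 * d)
  have h2 := mul_le_mul_of_nonneg_left hXb hd
  have h3 : 0 ≤ T * (Hh - 1) := mul_nonneg hT (by linarith)
  have h4 : 0 ≤ a * Hh * (T - 2 * d) :=
    mul_nonneg (mul_nonneg (by linarith) (by linarith)) (by linarith)
  have h5 := mul_le_mul_of_nonneg_left hAb hd
  linarith

/-- BASE on the positive side, U-step rounded up off a tie: `E_b ≤ a·h + 2h`, `ŝ_b ≥ U + 4h`.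
[cell] -/
theorem spine_base_pos1 {T Hh U a d Eb Ab Xb : ℤ} (hU : U = 2 * T * Hh) (hT2d : 2 * d + 2 ≤ T)
    (hHh : 1 ≤ Hh) (ha : 1 ≤ a) (hd : 0 ≤ d) (hEb : Eb ≤ a * Hh + 2 * Hh)
    (hAb : U + 4 * Hh ≤ Ab) (hXb : Ab - 2 * Eb ≤ Xb) :
    T * Eb + (d - 1 - a) * U ≤ d * Xb := by
  subst hU
  have h1 := mul_le_mul_of_nonneg_left hEb (by linarith : (0 : ℤ) ≤ T + 2 * d)
  have h2 := mul_le_mul_of_nonneg_left hXb hd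
  have h4 : 0 ≤ a * Hh * (T - 2 * d) :=
    mul_nonneg (mul_nonneg (by linarith) (by linarith)) (by linarith)
  have h5 := mul_le_mul_of_nonneg_left hAb hd
  linarith

/-- BASE on the positive side, U-step rounded up at a tie (to even): `E_b ≤ 1 + a·h + 2h`,
`ŝ_b ≥ U + 8h`. [cell] -/
theorem spine_base_pos2 {T Hh U a d Eb Ab Xb : ℤ} (hU : U = 2 * T * Hh) (hT2d : 2 * d + 2 ≤ T)
    (hHh : 1 ≤ Hh) (ha : 1 ≤ a) (hd : 0 ≤ d) (hEb : Eb ≤ 1 + a * Hh + 2 * Hh)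
    (hAb : U + 8 * Hh ≤ Ab) (hXb : Ab - 2 * Eb ≤ Xb) :
    T * Eb + (d - 1 - a) * U ≤ d * Xb := by
  subst hU
  have h1 := mul_le_mul_of_nonneg_left hEb (by linarith : (0 : ℤ) ≤ T + 2 * d)
  have h2 := mul_le_mul_of_nonneg_left hXb hd
  have h4 : 0 ≤ (a * Hh - 1) * (T - 2 * d) := mul_nonneg (by nlinarith) (by linarith)
  have h6 : 0 ≤ d * (Hh - 1) := mul_nonneg hd (by linarith)
  have h5 := mul_le_mul_of_nonneg_left hAb hd
  linarith

/-- PROPAGATION: from `b` on, every step adds at most `H` to `E` (`T·H = U`) and never decreases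
`X⁻`; the base `T·E_b + (n-b)·U ≤ d·X⁻_b` becomes `T·E_n ≤ d·X⁻_n`. [cell] -/
theorem spine_propagate {T U H d : ℤ} {E X : ℕ → ℤ} {b n : ℕ} (hbn : b ≤ n) (hT : 0 ≤ T)
    (hTH : T * H = U) (hd : 0 ≤ d)
    (hE : ∀ j, b ≤ j → j < n → E (j + 1) ≤ E j + H)
    (hX : ∀ j, b ≤ j → j < n → X j ≤ X (j + 1))
    (hbase : T * E b + ((n : ℤ) - b) * U ≤ d * X b) : T * E n ≤ d * X n := by
  suffices key : ∀ i, b + i ≤ n →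
      T * E (b + i) + ((n : ℤ) - (b + i : ℕ)) * U ≤ d * X (b + i) by
    have h := key (n - b) (by omega)
    have e : b + (n - b) = n := by omega
    rw [e] at h
    simpa using h
  intro i
  induction i with
  | zero => intro _; simpa using hbase
  | succ i ih =>
      intro hi
      have h1 := ih (by omega)
      have h2 := mul_le_mul_of_nonneg_left (hE (b + i) (by omega) (by omega)) hT
      have h3 := mul_le_mul_of_nonneg_left (hX (b + i) (by omega) (by omega)) hd
      rw [mul_add, hTH] at h2
      have hc : ((n : ℤ) - (b + i + 1 : ℕ)) = ((n : ℤ) - (b + i : ℕ)) - 1 := by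
        push_cast; ring
      rw [show b + (i + 1) = b + i + 1 from rfl, hc]
      linarith

/-! ### The integer model of the recursive sum; cast helpers -/

/-- `accZ m z i`: the recursive sum of the integer letters `z 0, …, z i` with one integer RNE to
`m + 1` bits per addition (no exponent limits). [cell] -/
def accZ (m : ℕ) (z : ℕ → ℤ) : ℕ → ℤ
  | 0 => rneZ m (z 0)
  | i + 1 => rneZ m (accZ m z i + z (i + 1))

/-- `|A| ≤ B` in `ℚ` gives `natAbs A ≤ B`. [folklore] -/
theorem natAbs_le_of_abs_cast_le {A : ℤ} {B : ℕ} (h : |(A : ℚ)| ≤ (B : ℚ)) : A.natAbs ≤ B := by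
  have h1 : ((A.natAbs : ℤ) : ℚ) ≤ (B : ℚ) := by rw [Nat.cast_natAbs]; push_cast; exact h
  exact_mod_cast h1

/-- `B ≤ |A|` in `ℚ` gives `B ≤ natAbs A`. [folklore] -/
theorem le_natAbs_of_cast_le_abs {A : ℤ} {B : ℕ} (h : (B : ℚ) ≤ |(A : ℚ)|) : B ≤ A.natAbs := by
  have h1 : (B : ℚ) ≤ ((A.natAbs : ℤ) : ℚ) := by rw [Nat.cast_natAbs]; push_cast; exact h
  exact_mod_cast h1

/-! ### A-priori growth of the accumulator (rational) -/

section Grid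

variable {G M m0 E : ℕ} {x : ℕ → ℚ}
  (hx : ∀ j, ∃ z : ℤ, x j = (z : ℚ) / 2 ^ G ∧ z.natAbs ≤ M ∧ (z % 2 = 0 ∨ z.natAbs ≤ m0))
  (hq : φ.qexp ≤ -(G : ℤ)) (hR : (2 : ℚ) ^ (φ.manBits + E + 3) ≤ φ.maxRat)
  (hm0M : m0 ≤ M) (hMT : M ≤ 2 ^ (φ.manBits + 1))
include hx hq hR hm0M hMT

/-- A-PRIORI GROWTH: `|ŝ_{j₀+t}| ≤ (M(j₀+1) + 2Mt)/2^G` (each step moves the accumulator by at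
most `|x| + |δ| ≤ 2|x|`). [folklore] -/
theorem abs_seqSum_le_growth {j0 : ℕ} (hj0 : M * j0 + m0 < 2 ^ (φ.manBits + 1)) :
    ∀ t, |(seqSum φ x (j0 + t)).toRat| ≤ ((M : ℚ) * ((j0 + 1 : ℕ) : ℚ) + 2 * M * t) / 2 ^ G := by
  have hGpos : (0 : ℚ) < 2 ^ G := by positivity
  have hxle : ∀ i, |x i| ≤ (M : ℚ) / 2 ^ G := by
    intro i
    obtain ⟨z, hz, hzM, -⟩ := hx i
    rw [hz, abs_div, abs_of_pos hGpos, ← Int.cast_abs, Int.abs_eq_natAbs, Int.cast_natCast]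
    exact div_le_div_of_nonneg_right (by exact_mod_cast hzM) hGpos.le
  intro t
  induction t with
  | zero =>
      rw [Nat.add_zero, seqSum_exact_prefixG hx hq hR hm0M hMT hj0 j0 le_rfl]
      refine le_trans (abs_sum_le_sum_abs _ _) (le_trans (sum_abs_leG hx (j0 + 1)) (le_of_eq ?_))
      push_cast; ring
  | succ t ih =>
      rw [show j0 + (t + 1) = j0 + t + 1 from rfl]
      have hs := abs_step_err_le_term (φ := φ) x (j0 + t)
      have h1 := abs_add_le (seqSum φ x (j0 + t)).toRat (x (j0 + t + 1))
      have h2 := hxle (j0 + t + 1)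
      have h3 := abs_sub_abs_le_abs_sub (seqSum φ x (j0 + t + 1)).toRat
        ((seqSum φ x (j0 + t)).toRat + x (j0 + t + 1))
      have e : ((M : ℚ) * ((j0 + 1 : ℕ) : ℚ) + 2 * M * ((t + 1 : ℕ) : ℚ)) / 2 ^ G
          = ((M : ℚ) * ((j0 + 1 : ℕ) : ℚ) + 2 * M * (t : ℚ)) / 2 ^ G + 2 * ((M : ℚ) / 2 ^ G) := by
        push_cast; ring
      rw [e]
      linarith

end Grid

end Summit.Ventures.CertifiedArithmetic.LowPrec.Gemm
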